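import Summits.BirchSwinnertonDyer.Rank1Residual.Iwasawa.CyclotomicLayerOneCubic
import Summits.BirchSwinnertonDyer.Rank1Residual.Iwasawa.LayerOneRankCertificate
import HarnessLib

/-!
# `LayerRankGEAt W 3 1 (r + 2)` from a layer-1 point certificate over ANY cubic field with a root of
# `t³ − 3t + 1` (cell `bsd-eis`, seat `bsd-eis-k5-c3` gen 5; THEOREMS ONLY)

HONEST FRAMING (FULL-BSD rank-≤1 programme D-0033, cell `bsd-eis`, `run/shared/lean/pub/bsd-eis/`; rung K5, crux 3
`MazurMCOnCellB` = stmt-BirchSwinnertonDyer-19033, row A10-split, the nine F9 road-T1 displays). Nothing booked, no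
label moves. The glue between `CyclotomicLayerOneCubic.lean` (the first layer of every cyclotomic `ℤ₃`-extension of
`ℚ` is a cubic number field containing a root `θ` of `t³ − 3t + 1` and an endomorphism `θ ↦ θ² − 2`) and
`LayerOneRankCertificate.lean` (the `σ`-trick): a certificate valid for EVERY number field `K` with `[K : ℚ] = 3`,
a root `θ` and a `ℚ`-algebra endomorphism `σ` with `σθ = θ² − 2` — namely a point `Q ∈ E(K)` with `Q − σQ` of
infinite order — together with `r ≤ rank_ℤ E(ℚ)` gives the typed rank-growth input
`Iwasawa.LayerRankGEAt W 3 1 (r + 2)` of `Iwasawa/RankGrowthLayer.lean` («`r + 2 ≤ rank E(ℚ₁)`») IN THE KERNEL.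
(`σ³ = 1` is automatic: `K = ℚ(θ)` by the power basis `MonicCubic.pb`, and `σ³θ = θ` is a polynomial identity
modulo `t³ − 3t + 1`.)

References: R. Greenberg, LNM 1716 (1999) Thm. 1.9 (p. 63) [GreenbergLNM1716]; L. C. Washington, *Introduction to
Cyclotomic Fields* §13.1 [Washington1997]; J. H. Silverman, AEC (2009) Thm. VIII.6.7 [SilvermanAEC2009].
-/

noncomputable section

open scoped Classical

open Module WeierstrassCurve WeierstrassCurve.Affine
  Literature.NumberTheory.EllipticCurves Literature.NumberTheory.NumberFields
  Summit.BirchSwinnertonDyer.Rank1Residual.Iwasawa.LayerOneRank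

set_option autoImplicit false

namespace Summit.BirchSwinnertonDyer.Rank1Residual.Iwasawa.LayerOneRank

/-- `σ³ = 1` for a `ℚ`-algebra endomorphism `σ` of a cubic number field `K = ℚ(θ)`, `θ³ − 3θ + 1 = 0`, with
`σθ = θ² − 2` (`σ³θ = θ` is a polynomial identity mod `t³ − 3t + 1`; `PowerBasis.algHom_ext`). [folklore] -/
theorem sigma_cube_eq_self {K : Type*} [Field K] [NumberField K] (h3 : finrank ℚ K = 3) {θ : K}
    (hθ : θ ^ 3 - 3 * θ + 1 = 0) (σ : K →ₐ[ℚ] K) (hσ : σ θ = θ ^ 2 - 2) (x : K) :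
    σ (σ (σ x)) = x := by
  have hθ' := aeval_poly_eq_zero hθ
  let pb := MonicCubic.pb irreducible_polyQ hθ' h3
  have hgen : pb.gen = θ := MonicCubic.pb_gen irreducible_polyQ hθ' h3
  have h1 : σ (σ (σ θ)) = θ := by
    simp only [map_sub, map_pow, map_ofNat, hσ]
    linear_combination (2 + 5 * θ - θ ^ 2 - 5 * θ ^ 3 + θ ^ 5) * hθ
  have key : (σ.comp (σ.comp σ)) = AlgHom.id ℚ K := by
    apply pb.algHom_ext
    rw [hgen, AlgHom.comp_apply, AlgHom.comp_apply, h1, AlgHom.id_apply]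
  have := congrArg (fun f : K →ₐ[ℚ] K => f x) key
  simpa using this

/-- **`LayerRankGEAt W 3 1 (r + 2)` from a layer-1 point certificate** (F9 road T1, kernel form): `W/ℚ` globally
minimal elliptic with `r ≤ rank_ℤ E(ℚ)`; if over EVERY cubic number field `K` with a root `θ` of `t³ − 3t + 1` and a
`ℚ`-endomorphism `σ`, `σθ = θ² − 2`, some point `Q ∈ E(K)` has `Q − σQ` of infinite order, then
`r + 2 ≤ rank_ℤ E(κ.layer 1)` for every cyclotomic `κ : ZpExtension ℚ 3` (`κ.layer 1` is such a `K`: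
`CyclotomicLayerOne.exists_cubicRoot_and_endomorphism_layer_one`, `ZpExtension.finrank_layer_holds`), i.e. the
typed rank-growth certificate `LayerRankGEAt W 3 1 (r + 2)` holds — discharging the binder `hm'` of
`Iwasawa.X2_mazurMainConjectureAt_of_layerRankGEAt'`. [cite: GreenbergLNM1716, Thm. 1.9 (p. 63)]
[cite: Washington1997, §13.1] [cite: SilvermanAEC2009, Thm. VIII.6.7] -/
theorem layerRankGEAt_of_cubicLayerCert (W : WeierstrassCurve ℚ) [W.IsElliptic] [W.IsGloballyMinimal]
    {r : ℕ} (hr : r ≤ W.mordellWeilRank)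
    (cert : ∀ (K : Type) [Field K] [NumberField K], finrank ℚ K = 3 →
      ∀ θ : K, θ ^ 3 - 3 * θ + 1 = 0 → ∀ σ : K →ₐ[ℚ] K, σ θ = θ ^ 2 - 2 →
        ∃ Q : (W.baseChange K).toAffine.Point, ¬ IsOfFinAddOrder (Q - Point.map (W' := W.toAffine) σ Q)) :
    LayerRankGEAt W 3 1 (r + 2) := by
  intro κ hκ
  haveI : FiniteDimensional ℚ (κ.layer 1) := κ.finiteDimensional_layer_holds 1
  haveI : NumberField (κ.layer 1) := NumberField.of_module_finite ℚ (κ.layer 1)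
  obtain ⟨θ, σr, hθ, hσr⟩ := CyclotomicLayerOne.exists_cubicRoot_and_endomorphism_layer_one hκ
  have h3 : finrank ℚ (κ.layer 1) = 3 := by
    have h := κ.finrank_layer_holds 1
    rw [pow_one] at h
    convert h
  let σ : κ.layer 1 →ₐ[ℚ] κ.layer 1 := σr.toRatAlgHom
  have hσ : σ θ = θ ^ 2 - 2 := hσr
  obtain ⟨Q, hQ⟩ := cert (κ.layer 1) h3 θ hθ σ hσ
  have h := add_two_le_mordellWeilRank_of_sigma W σ (sigma_cube_eq_self h3 hθ σ hσ) hr Q hQ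
  convert h

end Summit.BirchSwinnertonDyer.Rank1Residual.Iwasawa.LayerOneRank

end
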